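import Summits.QuantumFields.YangMills.Theorems.BalabanUVNodesProp4UniformAtRecord
import Literature.MathematicalPhysics.QuantumFieldTheory.Balaban1983to89.Node00.BgLettersPrOfRecord
import HarnessLib

/-!
# [B11] PROP. 4 AT THE RECORD, FRAMED EDITION (ρ-frame-min) — THE G-DOOR RE-PRESSED at node00-def-Y's framed letters `Prop4UniformPrAtRecord` ∕ `Prop4Letter{H,C,Columns,Symm}PrAtRecord`
# ((A3) ✓`Node00.BgLettersPrOfRecord`): monotonicity, the `‖J‖ ≤ nJ` door, (ℓc) outright, and the three record-letter assemblies — twins of ✓`BalabanUVNodesProp4UniformAtRecord`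

Cell `pub-ymgap` ∕ `ym-nodeO-ideate`, porter lineage `ymgap-nodeO-port-PTB-1` (gen 9); re-press (B) of director-ym g23 №608 (ROAD WORD FINAL), «the 7 G-door names» part 1; filed behind
the ACCEPT of (A3) ✓p829152; `--kind proof --supports stmt-QuantumFields-27238 --as helper`; count-neutral; NEW basename, append-nothing (the frame-free ✓`…Prop4UniformAtRecord` stays,
USE-HELD).  [B11] = [Balaban1985Variational]; [BIII] = [Balaban1985BackgroundPropagators].

RE-KEYING RULE (def-Y PRICE #2 (B), bus I.13297): `Q`-argument `QOfRecord U₀ ↦ QprOfRecord U₀ 𝔥`, `Q′`-argument `Q′♭ = QflatOfRecord ↦ QprimeOfRecord U₀` (block means, [BIII] (3.114)),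
`C^{sl} ↦ C^{sl,pr}`, every `Prop4…AtRecord` letter ↦ its `…PrAtRecord` twin over the datum `𝔥 : FrameDatum (F.P K) N k U₀`; `J` (28), `B` (20), `V₀`, the numbers (ℓa-num) and
`c4OfRecord` are chart-free and used VERBATIM.  Proofs are the frame-free proofs word for word (the generic ✓`quadAnalytic_W80_of_letters` ∕ ✓`c4OfLetters_mono_nJ` ∕
✓`c4OfRecord_le_numeric` ∕ ✓`prop4LetterNum_explicit` ∕ ✓`prop4LetterV0AtRecord_of_window` do not see the chart).

WHAT IS PROVED (0 def, 0 sorry, axioms standard; ns `Summit.QuantumFields.YangMills.Theorems.Prop4UniformAtRecord`):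
* `prop4UniformPrAtRecord_mono` (monotone in `C₄`), ★ `prop4UniformPrAtRecord_of_letters_of_norm_J_le` (def-Y ✓`prop4UniformPrAtRecord_of_letters` with `‖J‖ ≤ nJ`),
  ★ `prop4LetterSymmPrAtRecord_holds` ((ℓc) OUTRIGHT at `Q′ = QprimeOfRecord U₀`: ✓N07 `DeltaPiCurOfRecord_pairSum_comm` is `Q′`-generic);
* ★★ `prop4UniformPrAtRecord_of_recordLetters` ∕ ★★★ `…_numeric` ∕ ★★★ `…_window` — the framed Prop. 4 at the record from (ℓa-H)ᵖʳ, (ℓa-C)ᵖʳ, (ℓd)ᵖʳ + print's domain clauses,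
  constants CLOSED TERMS exactly as in the frame-free door.

HONEST FRAMING.  An assembly re-keyed, nothing else: (ℓa-H)ᵖʳ, (ℓa-C)ᵖʳ, (ℓd)ᵖʳ are NOT proved here (hypotheses); no frame is constructed ((A1) is node00-def-Y's); `hpos`∕`hQ` for the
framed pair stay DISPLAYED binders; nothing of [B11] Prop. 4 ∕ [BIII] Thm 3.12 is proved; (R1)∕(R2) OPEN; K0ᴬ ⟨stmt-QuantumFields-27238⟩ NOT closed; NODE O 0∕1; COUNT 8∕28 · K 1∕4
UNMOVED; finite `𝕋⁴_{L^K}` at fixed ε — NOT continuum ∕ ℝ⁴ ∕ OS ∕ Clay; **the Yang–Mills mass gap (Clay) is NOT proved by any of this.**  No `sorry`, `instance`, `notation`,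
`set_option`; standard axioms.
-/

noncomputable section

open scoped Matrix Matrix.Norms.L2Operator InnerProductSpace ComplexConjugate BigOperators

namespace Summit.QuantumFields.YangMills.Theorems.Prop4UniformAtRecord

open Literature.MathematicalPhysics.QuantumFieldTheory.Balaban1983to89
open T4Continuum
open B9SectCLatticeCarrier (Bond)
open B9Eq310DeltaPrime (plaqHolU)
open B11Eq103H1Complex (SiteL2K BondL2K)
open B11Eq115Space (NegSup NegSize Space115 levWeight)
open B11Prop6Scheme (Prop4Hyp)
open B13Contraction113 (QuadAnalytic)
open Node00
open Summit.QuantumFields.YangMills.Theorems.N07DeltaPiOfRecordPairing (DeltaPiCurOfRecord_pairSum_comm)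

section Record

variable (F : T4Family) (N : ℕ) [NeZero N] (K k : ℕ) (Ω : ℕ → Set (Site (F.P K) 0)) (U₀ : GaugeField (F.P K) 0 (SU N))
variable [Fact (0 < (F.L : ℝ))] [Fact (0 < (F.P K).eta k)] [Fact (0 < c0Rec F K k)] [Fact (∀ c, 0 < wBRec F K k c)]

/-! ## §1  Bookkeeping at the framed letter: monotonicity in `C₄`, the `‖J‖ ≤ nJ` door, (ℓc) outright -/

/-- **Raising the constant**: `Prop4UniformPrAtRecord` is monotone in `C₄` (twin of def-Y ✓`prop4UniformAtRecord_mono`). [cite: Balaban1985Variational, Prop. 4 p.293 (bookkeeping)] -/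
theorem prop4UniformPrAtRecord_mono (𝔥 : FrameDatum (F.P K) N k U₀) (levB : PBond (F.P K) k → ℕ) (a : ℝ)
    (hpos : ∀ x, x ≠ 0 → 0 < RCLike.re ⟪x, laplaceAOfRecord F N k U₀ (QprOfRecord F N k U₀ 𝔥) (QprimeOfRecord F N k U₀) a x⟫_ℂ)
    (hQ : Function.Surjective (QprOfRecord F N k U₀ 𝔥)) (εC : ℝ)
    (Gp : SiteL2K ℂ (F.P K).d (fun _ => (F.P K).sitesPerDir 0) (c0Rec F K k) (WRec N) →ₗ[ℂ]
      SiteL2K ℂ (F.P K).d (fun _ => (F.P K).sitesPerDir 0) (c0Rec F K k) (WRec N)) {C₄ C₄' R' : ℝ}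
    (h : Prop4UniformPrAtRecord F N K k Ω U₀ 𝔥 levB a hpos hQ εC Gp C₄ R') (hle : C₄ ≤ C₄') :
    Prop4UniformPrAtRecord F N K k Ω U₀ 𝔥 levB a hpos hQ εC Gp C₄' R' :=
  ⟨⟨fun Y hY => (h.1.quad Y hY).trans (mul_le_mul_of_nonneg_right hle (sq_nonneg _)), h.1.lineAnalytic⟩, h.2⟩

/-- ★ **THE FRAMED DOOR WITH `‖J‖` REPLACED BY A BOUND `nJ`** (`‖JOfRecordAtBg …‖ ≤ nJ`): def-Y ✓`prop4UniformPrAtRecord_of_letters` + monotonicity + ✓`c4OfLetters_mono_nJ`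
(twin of def-Y ✓`prop4UniformAtRecord_of_letters_of_norm_J_le`). [cite: Balaban1985Variational, Prop. 4 (97)–(98) pp.292–293, (28) p.282] -/
theorem prop4UniformPrAtRecord_of_letters_of_norm_J_le (𝔥 : FrameDatum (F.P K) N k U₀) (levB : PBond (F.P K) k → ℕ) (a : ℝ)
    (hpos : ∀ x, x ≠ 0 → 0 < RCLike.re ⟪x, laplaceAOfRecord F N k U₀ (QprOfRecord F N k U₀ 𝔥) (QprimeOfRecord F N k U₀) a x⟫_ℂ)
    (hQ : Function.Surjective (QprOfRecord F N k U₀ 𝔥)) {εC : ℝ}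
    (Gp : SiteL2K ℂ (F.P K).d (fun _ => (F.P K).sitesPerDir 0) (c0Rec F K k) (WRec N) →ₗ[ℂ]
      SiteL2K ℂ (F.P K).d (fun _ => (F.P K).sitesPerDir 0) (c0Rec F K k) (WRec N))
    {b C₂ c₄ aC CV RV R' θ₃ θE θE' N₁ nJ : ℝ}
    (hH : Prop4LetterHPrAtRecord F N K k Ω U₀ 𝔥 levB a hpos hQ b) (hC : Prop4LetterCPrAtRecord F N K k Ω U₀ 𝔥 levB C₂ c₄)
    (hnum : Prop4LetterNum b C₂ c₄ aC εC RV R') (hV : Prop4LetterV0AtRecord F N K k Ω U₀ CV RV) (hsym : Prop4LetterSymmPrAtRecord F N K k Ω U₀ Gp)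
    (hcol : Prop4LetterColumnsPrAtRecord F N K k Ω U₀ 𝔥 levB a hpos hQ εC Gp R' θ₃ θE θE' N₁) (hJ : ‖JOfRecordAtBg F N K k Ω U₀‖ ≤ nJ) :
    Prop4UniformPrAtRecord F N K k Ω U₀ 𝔥 levB a hpos hQ εC Gp (c4OfRecord N nJ b C₂ εC aC CV R' θ₃ θE θE' N₁) R' :=
  prop4UniformPrAtRecord_mono F N K k Ω U₀ 𝔥 levB a hpos hQ εC Gp
    (prop4UniformPrAtRecord_of_letters F N K k Ω U₀ 𝔥 levB a hpos hQ Gp hH hC hnum hV hsym hcol)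
    (c4OfLetters_mono_nJ (rhoRec N) (tauRecCLM N) hcol.1.1 hJ)

omit [Fact (∀ c, 0 < wBRec F K k c)] in
/-- ★ **(ℓc) `Prop4LetterSymmPrAtRecord` HOLDS OUTRIGHT** — every background, any `G′`: the (27)-symmetry of `Δπ := DeltaPiCurOfRecord … Gp (QprimeOfRecord U₀)` (block `Q′`, framed edition; twin of ✓`prop4LetterSymmAtRecord_holds`) in the raw-sum spelling, from ✓N07
`DeltaPiCurOfRecord_pairSum_comm` (`η^d ≠ 0` cancelled). [cite: Balaban1985Variational, (27) p.282, (80) p.290; Balaban1985BackgroundPropagators, (3.119) p.419] -/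
theorem prop4LetterSymmPrAtRecord_holds
    (Gp : SiteL2K ℂ (F.P K).d (fun _ => (F.P K).sitesPerDir 0) (c0Rec F K k) (WRec N) →ₗ[ℂ]
      SiteL2K ℂ (F.P K).d (fun _ => (F.P K).sitesPerDir 0) (c0Rec F K k) (WRec N)) :
    Prop4LetterSymmPrAtRecord F N K k Ω U₀ Gp := by
  intro Y₁ Y₂
  have hη : ((((F.P K).eta k : ℝ) : ℂ)) ^ (F.P K).d ≠ 0 :=
    pow_ne_zero _ (Complex.ofReal_ne_zero.2 (ne_of_gt (Fact.out : 0 < (F.P K).eta k)))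
  exact mul_left_cancel₀ hη (DeltaPiCurOfRecord_pairSum_comm F N k U₀ Ω Gp (QprimeOfRecord F N k U₀) Y₁ Y₂)

/-! ## §2  The framed Prop. 4 at the record from the record letters (twins of ✓`prop4UniformAtRecord_of_recordLetters{,_numeric,_window}`, proofs word for word) -/

/-- ★★★ **THE (R2) DOOR — [B11] PROP. 4 (97)–(98) FOR THE RECORD'S `W`, «uniform in k» BY PROVENANCE.**  GIVEN the displayed letters (ℓa-H) `Prop4LetterHAtRecord … b`
((46)∕(117): `‖H₁♭ X‖ ≤ b‖X‖`, [B9] Thm 3.13 class), (ℓa-C) `Prop4LetterCAtRecord … C₂ c₄` ((44) on the traceless slice + Sect. G analyticity), print's small-field window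
`‖U₀(∂p) − 1‖ ≤ αη²` with the level-weight profile `(ω, Ω)`, (ℓd) `Prop4LetterColumnsAtRecord …` at `εC := r` on the radius `R′` ([B9] (3.132)∕(55)∕(73) kernel columns) and a bound
`‖J(U₀)‖₍₋₃₎ ≤ nJ` ((28); ✓`Node00.norm_JOfRecordAtBg_le` gives `nJ = C₁B₃ε₁` under the (14) window) — THEN `Prop4UniformPrAtRecord F N K k Ω U₀ 𝔥 levB a hpos hQ r Gp C₄ R′` with
`εC = aC := r = min (c₄∕4) (min ½ (1∕(16(bC₂+1))))`, `R′ = min r ((1 − 4bC₂(r + r))∕16)`, `C₄ = c4OfRecord N nJ b C₂ r r CV R′ θ₃ θE θE′ N₁`, `CV = 1024(d−1)(ωΩ)³N(αω² + 1∕16) +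
(d−1)(ωΩ)³(136 + 2ωΩ)N` — ALL CLOSED TERMS in the letters' constants.  Discharged on the way: (ℓc) symmetry (§2), (ℓb) V₀ (§2 ∕ ✓`Prop4V0AtRecord`), the scalars (§2), via def-Y's
✓`prop4UniformAtRecord_of_letters_of_norm_J_le`.  HONEST: an assembly; (ℓa-H), (ℓa-C), (ℓd) are NOT proved here. [cite: Balaban1985Variational, Prop. 4 (97)–(98) pp.292–293] -/
theorem prop4UniformPrAtRecord_of_recordLetters (𝔥 : FrameDatum (F.P K) N k U₀) (levB : PBond (F.P K) k → ℕ) (a : ℝ)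
    (hpos : ∀ x, x ≠ 0 → 0 < RCLike.re ⟪x, laplaceAOfRecord F N k U₀ (QprOfRecord F N k U₀ 𝔥) (QprimeOfRecord F N k U₀) a x⟫_ℂ)
    (hQ : Function.Surjective (QprOfRecord F N k U₀ 𝔥))
    (Gp : SiteL2K ℂ (F.P K).d (fun _ => (F.P K).sitesPerDir 0) (c0Rec F K k) (WRec N) →ₗ[ℂ]
      SiteL2K ℂ (F.P K).d (fun _ => (F.P K).sitesPerDir 0) (c0Rec F K k) (WRec N))
    {b C₂ c₄ α ω Ωw θ₃ θE θE' N₁ nJ : ℝ} (hb : 0 ≤ b) (hC₂ : 0 ≤ C₂) (hc₄ : 0 < c₄)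
    (hH : Prop4LetterHPrAtRecord F N K k Ω U₀ 𝔥 levB a hpos hQ b) (hC : Prop4LetterCPrAtRecord F N K k Ω U₀ 𝔥 levB C₂ c₄)
    (hα : 0 ≤ α)
    (hpl : ∀ p : B9SectCLatticeCarrier.Plaq (F.P K).d (fun _ => (F.P K).sitesPerDir 0),
      ‖(plaqHolU (unitsOfRecord F N U₀) p : Matrix (Fin N) (Fin N) ℂ) - 1‖ ≤ α * (F.P K).eta k ^ 2)
    (hω1 : 1 ≤ ω) (hΩ1 : 1 ≤ Ωw) (hω : (NegSup.wSup (levWeight (F.L : ℝ) ((F.P K).eta k) (bondLevLit F Ω k) 1) : ℝ) ≤ ω)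
    (hΩ₀ : (NegSup.wInvSup (levWeight (F.L : ℝ) ((F.P K).eta k) (bondLevLit F Ω k) 1) : ℝ) ≤ Ωw)
    (hΩ₁ : (NegSup.wInvSup (levWeight (F.L : ℝ) ((F.P K).eta k) (pairLevLit F Ω k) 2) : ℝ) ≤ Ωw)
    (hcol : letI r : ℝ := min (c₄ / 4) (min (1 / 2) (1 / (16 * (b * C₂ + 1))))
      Prop4LetterColumnsPrAtRecord F N K k Ω U₀ 𝔥 levB a hpos hQ r Gp (min r ((1 - 4 * b * C₂ * (r + r)) * (1 / 16))) θ₃ θE θE' N₁)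
    (hJ : ‖JOfRecordAtBg F N K k Ω U₀‖ ≤ nJ) :
    letI r : ℝ := min (c₄ / 4) (min (1 / 2) (1 / (16 * (b * C₂ + 1))))
    letI R' : ℝ := min r ((1 - 4 * b * C₂ * (r + r)) * (1 / 16))
    letI CV : ℝ := 1024 * (((F.P K).d - 1 : ℕ) : ℝ) * (ω * Ωw) ^ 3 * N * (α * ω ^ 2 + 1 / 16)
        + (((F.P K).d - 1 : ℕ) : ℝ) * (ω * Ωw) ^ 3 * (136 + 2 * (ω * Ωw)) * N
    Prop4UniformPrAtRecord F N K k Ω U₀ 𝔥 levB a hpos hQ r Gp (c4OfRecord N nJ b C₂ r r CV R' θ₃ θE θE' N₁) R' :=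
  prop4UniformPrAtRecord_of_letters_of_norm_J_le F N K k Ω U₀ 𝔥 levB a hpos hQ Gp hH hC (prop4LetterNum_explicit hb hC₂ hc₄ (by norm_num))
    (prop4LetterV0AtRecord_of_window F N K k Ω U₀ hα hpl hω1 hΩ1 hω hΩ₀ hΩ₁) (prop4LetterSymmPrAtRecord_holds F N K k Ω U₀ Gp) hcol hJ

/-- ★★★ **THE SAME WITH A PURELY NUMERIC CONSTANT** (def-Y's `c4OfRecord` carries `‖rhoRec N‖·‖tauRecCLM N‖`; here they are replaced by `1·N`, ✓`c4OfRecord_le_numeric` +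
✓`prop4UniformAtRecord_mono`): `C₄ = Nθ₃nJ + (N₁C₂ℓ² + NθE′) + NθE·N₁C₂ℓ²·R′ + N(1 + θER′)CVℓ²`, `ℓ = (1 − 4bC₂(r+r))⁻¹` — a polynomial in `N, d, b, C₂, c₄, α, ω, Ω, θ₃, θE, θE′, N₁,
nJ` and nothing else: print's «The constants a₃, C₄ depend on d and L only» AS PROVENANCE, given k-free letters. [cite: Balaban1985Variational, Prop. 4 (97)–(98) pp.292–293] -/
theorem prop4UniformPrAtRecord_of_recordLetters_numeric (𝔥 : FrameDatum (F.P K) N k U₀) (levB : PBond (F.P K) k → ℕ) (a : ℝ)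
    (hpos : ∀ x, x ≠ 0 → 0 < RCLike.re ⟪x, laplaceAOfRecord F N k U₀ (QprOfRecord F N k U₀ 𝔥) (QprimeOfRecord F N k U₀) a x⟫_ℂ)
    (hQ : Function.Surjective (QprOfRecord F N k U₀ 𝔥))
    (Gp : SiteL2K ℂ (F.P K).d (fun _ => (F.P K).sitesPerDir 0) (c0Rec F K k) (WRec N) →ₗ[ℂ]
      SiteL2K ℂ (F.P K).d (fun _ => (F.P K).sitesPerDir 0) (c0Rec F K k) (WRec N))
    {b C₂ c₄ α ω Ωw θ₃ θE θE' N₁ nJ : ℝ} (hb : 0 ≤ b) (hC₂ : 0 ≤ C₂) (hc₄ : 0 < c₄)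
    (hH : Prop4LetterHPrAtRecord F N K k Ω U₀ 𝔥 levB a hpos hQ b) (hC : Prop4LetterCPrAtRecord F N K k Ω U₀ 𝔥 levB C₂ c₄)
    (hα : 0 ≤ α)
    (hpl : ∀ p : B9SectCLatticeCarrier.Plaq (F.P K).d (fun _ => (F.P K).sitesPerDir 0),
      ‖(plaqHolU (unitsOfRecord F N U₀) p : Matrix (Fin N) (Fin N) ℂ) - 1‖ ≤ α * (F.P K).eta k ^ 2)
    (hω1 : 1 ≤ ω) (hΩ1 : 1 ≤ Ωw) (hω : (NegSup.wSup (levWeight (F.L : ℝ) ((F.P K).eta k) (bondLevLit F Ω k) 1) : ℝ) ≤ ω)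
    (hΩ₀ : (NegSup.wInvSup (levWeight (F.L : ℝ) ((F.P K).eta k) (bondLevLit F Ω k) 1) : ℝ) ≤ Ωw)
    (hΩ₁ : (NegSup.wInvSup (levWeight (F.L : ℝ) ((F.P K).eta k) (pairLevLit F Ω k) 2) : ℝ) ≤ Ωw)
    (hcol : letI r : ℝ := min (c₄ / 4) (min (1 / 2) (1 / (16 * (b * C₂ + 1))))
      Prop4LetterColumnsPrAtRecord F N K k Ω U₀ 𝔥 levB a hpos hQ r Gp (min r ((1 - 4 * b * C₂ * (r + r)) * (1 / 16))) θ₃ θE θE' N₁)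
    (hJ : ‖JOfRecordAtBg F N K k Ω U₀‖ ≤ nJ) :
    letI r : ℝ := min (c₄ / 4) (min (1 / 2) (1 / (16 * (b * C₂ + 1))))
    letI R' : ℝ := min r ((1 - 4 * b * C₂ * (r + r)) * (1 / 16))
    letI CV : ℝ := 1024 * (((F.P K).d - 1 : ℕ) : ℝ) * (ω * Ωw) ^ 3 * N * (α * ω ^ 2 + 1 / 16)
        + (((F.P K).d - 1 : ℕ) : ℝ) * (ω * Ωw) ^ 3 * (136 + 2 * (ω * Ωw)) * N
    Prop4UniformPrAtRecord F N K k Ω U₀ 𝔥 levB a hpos hQ r Gp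
      ((N * θ₃ * nJ + (N₁ * C₂ * (1 / (1 - 4 * b * C₂ * (r + r))) ^ 2 + N * θE')
        + N * θE * (N₁ * C₂ * (1 / (1 - 4 * b * C₂ * (r + r))) ^ 2) * R'
        + N * (1 + θE * R') * CV * (1 / (1 - 4 * b * C₂ * (r + r))) ^ 2)) R' := by
  have hmain := prop4UniformPrAtRecord_of_recordLetters F N K k Ω U₀ 𝔥 levB a hpos hQ Gp hb hC₂ hc₄ hH hC hα hpl hω1 hΩ1 hω hΩ₀ hΩ₁ hcol hJ
  have hnum := prop4LetterNum_explicit (b := b) (C₂ := C₂) hb hC₂ hc₄ (by norm_num : (0 : ℝ) < 1 / 16)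
  obtain ⟨⟨hθ₃, hθE, hθE', hN₁⟩, -⟩ := hcol
  have hCV := (prop4LetterV0AtRecord_of_window F N K k Ω U₀ hα hpl hω1 hΩ1 hω hΩ₀ hΩ₁).1
  exact prop4UniformPrAtRecord_mono F N K k Ω U₀ 𝔥 levB a hpos hQ _ Gp hmain
    (c4OfRecord_le_numeric N ((norm_nonneg _).trans hJ) hCV hnum.2.2.2.2.2.2.1 hθ₃ hθE hθE' hN₁ hC₂)

/-! ## §3  The framed door at print's (14) current window -/

/-- ★★★ **THE DOOR AT THE (14) WINDOW** — `prop4UniformAtRecord_of_recordLetters_numeric` with the `‖J‖`-bound supplied by print's current clause of `U₀ ∈ 𝔘_k({Ω_j}, C₁B₃ε₁)`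
read bondwise (lit `InU2cur`, ✓`Node00.norm_JOfRecordAtBg_le`): the whole antecedent is now (ℓa-H), (ℓa-C), (ℓd) + DOMAIN CLAUSES of print (plaquette window, current window) + the
level-weight profile — no free numeric letter besides the constants. [cite: Balaban1985Variational, (2) p.278, (14) p.280, (28) p.282, Prop. 4 (97)–(98) pp.292–293] -/
theorem prop4UniformPrAtRecord_of_recordLetters_window (𝔥 : FrameDatum (F.P K) N k U₀) (levB : PBond (F.P K) k → ℕ) (a : ℝ)
    (hpos : ∀ x, x ≠ 0 → 0 < RCLike.re ⟪x, laplaceAOfRecord F N k U₀ (QprOfRecord F N k U₀ 𝔥) (QprimeOfRecord F N k U₀) a x⟫_ℂ)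
    (hQ : Function.Surjective (QprOfRecord F N k U₀ 𝔥))
    (Gp : SiteL2K ℂ (F.P K).d (fun _ => (F.P K).sitesPerDir 0) (c0Rec F K k) (WRec N) →ₗ[ℂ]
      SiteL2K ℂ (F.P K).d (fun _ => (F.P K).sitesPerDir 0) (c0Rec F K k) (WRec N))
    {b C₂ c₄ α ω Ωw θ₃ θE θE' N₁ C₁ B₃ ε₁ : ℝ} (hb : 0 ≤ b) (hC₂ : 0 ≤ C₂) (hc₄ : 0 < c₄)
    (hH : Prop4LetterHPrAtRecord F N K k Ω U₀ 𝔥 levB a hpos hQ b) (hC : Prop4LetterCPrAtRecord F N K k Ω U₀ 𝔥 levB C₂ c₄)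
    (hα : 0 ≤ α)
    (hpl : ∀ p : B9SectCLatticeCarrier.Plaq (F.P K).d (fun _ => (F.P K).sitesPerDir 0),
      ‖(plaqHolU (unitsOfRecord F N U₀) p : Matrix (Fin N) (Fin N) ℂ) - 1‖ ≤ α * (F.P K).eta k ^ 2)
    (hK : 0 ≤ C₁ * B₃ * ε₁) (h14 : B11Prop6Concrete.InU2cur (F.L : ℝ) ((F.P K).eta k) (bondLevLit F Ω k) (C₁ * B₃ * ε₁) (unitsOfRecord F N U₀))
    (hω1 : 1 ≤ ω) (hΩ1 : 1 ≤ Ωw) (hω : (NegSup.wSup (levWeight (F.L : ℝ) ((F.P K).eta k) (bondLevLit F Ω k) 1) : ℝ) ≤ ω)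
    (hΩ₀ : (NegSup.wInvSup (levWeight (F.L : ℝ) ((F.P K).eta k) (bondLevLit F Ω k) 1) : ℝ) ≤ Ωw)
    (hΩ₁ : (NegSup.wInvSup (levWeight (F.L : ℝ) ((F.P K).eta k) (pairLevLit F Ω k) 2) : ℝ) ≤ Ωw)
    (hcol : letI r : ℝ := min (c₄ / 4) (min (1 / 2) (1 / (16 * (b * C₂ + 1))))
      Prop4LetterColumnsPrAtRecord F N K k Ω U₀ 𝔥 levB a hpos hQ r Gp (min r ((1 - 4 * b * C₂ * (r + r)) * (1 / 16))) θ₃ θE θE' N₁) :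
    letI r : ℝ := min (c₄ / 4) (min (1 / 2) (1 / (16 * (b * C₂ + 1))))
    letI R' : ℝ := min r ((1 - 4 * b * C₂ * (r + r)) * (1 / 16))
    letI CV : ℝ := 1024 * (((F.P K).d - 1 : ℕ) : ℝ) * (ω * Ωw) ^ 3 * N * (α * ω ^ 2 + 1 / 16)
        + (((F.P K).d - 1 : ℕ) : ℝ) * (ω * Ωw) ^ 3 * (136 + 2 * (ω * Ωw)) * N
    Prop4UniformPrAtRecord F N K k Ω U₀ 𝔥 levB a hpos hQ r Gp
      ((N * θ₃ * (C₁ * B₃ * ε₁) + (N₁ * C₂ * (1 / (1 - 4 * b * C₂ * (r + r))) ^ 2 + N * θE')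
        + N * θE * (N₁ * C₂ * (1 / (1 - 4 * b * C₂ * (r + r))) ^ 2) * R'
        + N * (1 + θE * R') * CV * (1 / (1 - 4 * b * C₂ * (r + r))) ^ 2)) R' :=
  prop4UniformPrAtRecord_of_recordLetters_numeric F N K k Ω U₀ 𝔥 levB a hpos hQ Gp hb hC₂ hc₄ hH hC hα hpl hω1 hΩ1 hω hΩ₀ hΩ₁ hcol
    (norm_JOfRecordAtBg_le (F := F) (N := N) (k := k) (Ω := Ω) (U₀ := U₀) hK h14)

end Record

end Summit.QuantumFields.YangMills.Theorems.Prop4UniformAtRecord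

end
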